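import Summits.CriticalPhenomena.PercolationContinuityZ3.Theorems.PercNearOneGluingNoHeavyPcintThirdMem
import Summits.CriticalPhenomena.PercolationContinuityZ3.Theorems.PercNearOneGluingNoHeavyPcintChainMemKernel
import HarnessLib

/-!
# PCINT lane, reduced-state B3t certificates (bond): the computable (kernel) layer — `t`-units

Cell `prim-pcint` (PAPER-2 track (iii)), seat `prim-pcint-2` (gen 4); support file (`--supports stmt-CriticalPhenomena-4575`).
Does NOT build on p205010.  Kernel-evaluable mirror of the `t`-unit count `ctu` of `…ThirdMem` on the kernel states
`NawK.KState`: the t-site letter test `BondK.ctP` (det-paying letter whose site has two remembered incidences of different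
ages, all remembered incidences of age `≥ 3`) and the count `BondK.ctuK`, with the SOUNDNESS bridge `BondK.ctuK_le_ctu` and
`BondK.ctuK_le_cdetK`.  Together with `bchordK ≤ bchord`, `cdetK ≤ cdet` (`…ChordMemKernel`, `…ChainMemKernel`) this is
what makes the kernel weight dominate the semantic one (fewer units, fewer `t`-units among them, fewer chords).
-/

namespace Summit.CriticalPhenomena.PercolationContinuityZ3.Theorems.Pcint

open Finset Literature.Probability.Percolation Literature.Probability.LatticeModels

namespace BondK

open WinK (toSite toL addL adjL toSite_addL toSite_toL adj_iff_adjL toSite_inj length_toL length_addL)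
open NawK (KState toM mem_toM WF length_of_WF letters mem_letters nodup_letters l1L)

variable {d : ℕ}

/-! ### The kernel `t`-unit count -/

/-- Kernel T-SITE test of the letter `b`: det-paying, two remembered incidences of different ages, and every remembered
incidence of age `≥ 3`. [folklore] -/
def ctP (d kc : ℕ) (L : KState) (a b : Fin d × Bool) : Bool :=
  cdetP d kc L a b &&
    (L.any fun q => adjL d q.1 (addL (toL d a) (toL d b)) &&
      L.any fun q' => adjL d q'.1 (addL (toL d a) (toL d b)) && !(q'.2 == q.2)) &&
    (L.all fun q => !adjL d q.1 (addL (toL d a) (toL d b)) || decide (3 ≤ q.2))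

/-- Kernel `t`-unit count (mirror of `ctu`). [folklore] -/
def ctuK (d kc : ℕ) (L : KState) (a : Fin d × Bool) : ℕ := ((letters d).filter fun b => ctP d kc L a b).length

/-- `ctuK ≤ cdetK`. [folklore] -/
theorem ctuK_le_cdetK (τ kc : ℕ) (L : KState) (a : Fin d × Bool) : ctuK d kc L a ≤ cdetK d τ kc L a := by
  unfold ctuK cdetK
  refine le_trans ?_ (Nat.le_add_right _ _)
  rw [← List.countP_eq_length_filter, ← List.countP_eq_length_filter]
  refine List.countP_mono_left fun b _ hb => ?_
  unfold ctP at hb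
  simp only [Bool.and_eq_true] at hb
  exact hb.1.1

/-- `ctuK ≤ 2d`. [folklore] -/
theorem ctuK_le (kc : ℕ) (L : KState) (a : Fin d × Bool) : ctuK d kc L a ≤ 2 * d :=
  (List.length_filter_le _ _).trans (le_of_eq NawK.length_letters)

/-! ### Soundness of the `t`-unit count -/

/-- **A kernel t-site letter is a t-site.** [folklore] -/
theorem mem_ctSet_of_ctP {kc : ℕ} {L : KState} (hL : WF d L = true) {a b : Fin d × Bool} (h : ctP d kc L a b = true) :
    stepVec a + stepVec b ∈ ctSet kc (toM L : MState d) a := by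
  classical
  unfold ctP at h
  simp only [Bool.and_eq_true, List.any_eq_true, List.all_eq_true, Bool.or_eq_true, Bool.not_eq_true',
    decide_eq_true_eq, beq_eq_false_iff_ne] at h
  obtain ⟨⟨hdet, x, hx, hxadj, x', hx', hx'adj, hne⟩, hall⟩ := h
  have hlen : (addL (toL d a) (toL d b)).length = d := length_addL (length_toL a) (length_toL b)
  have hsite : (toSite (addL (toL d a) (toL d b)) : Site d) = stepVec a + stepVec b := by
    rw [toSite_addL (length_toL a) (length_toL b), toSite_toL, toSite_toL]
  rw [ctSet, mem_filter]
  refine ⟨mem_cdetSet_of_cdetP hL hdet, ?_, fun q hq => ?_⟩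
  · have hxl := length_of_WF hL hx
    have hx'l := length_of_WF hL hx'
    have h1 : ((toSite x.1 : Site d), x.2) ∈ bcinc (toM L : MState d) (stepVec a + stepVec b) :=
      mem_bcinc.2 ⟨mem_toM.2 ⟨x, hx, rfl⟩, by rw [← hsite]; exact (adj_iff_adjL hxl hlen).2 hxadj⟩
    have h2 : ((toSite x'.1 : Site d), x'.2) ∈ bcinc (toM L : MState d) (stepVec a + stepVec b) :=
      mem_bcinc.2 ⟨mem_toM.2 ⟨x', hx', rfl⟩, by rw [← hsite]; exact (adj_iff_adjL hx'l hlen).2 hx'adj⟩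
    exact one_lt_card.2 ⟨_, h1, _, h2, fun h => hne (congrArg Prod.snd h).symm⟩
  · obtain ⟨hqS, hqadj⟩ := mem_bcinc.1 hq
    obtain ⟨y, hy, rfl⟩ := mem_toM.1 hqS
    have hyl := length_of_WF hL hy
    rcases hall y hy with hna | h3
    · have h' : adjL d y.1 (addL (toL d a) (toL d b)) = true := (adj_iff_adjL hyl hlen).1 (by rw [hsite]; exact hqadj)
      rw [h'] at hna
      exact Bool.noConfusion hna
    · exact h3

/-- **The kernel `t`-unit count does not exceed the `t`-unit count.** [folklore] -/
theorem ctuK_le_ctu {kc : ℕ} {L : KState} (hL : WF d L = true) (a : Fin d × Bool) :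
    ctuK d kc L a ≤ ctu kc (toM L : MState d) a := by
  classical
  unfold ctuK ctu
  have hnd : ((letters d).filter fun b => ctP d kc L a b).Nodup := nodup_letters.filter _
  rw [← List.toFinset_card_of_nodup hnd]
  refine Finset.card_le_card_of_injOn (fun b => stepVec a + stepVec b) (fun b hb => ?_)
    (fun b _ b' _ h => stepVec_add_injective a h)
  rw [Finset.mem_coe, List.mem_toFinset, List.mem_filter] at hb
  rw [Finset.mem_coe]
  exact mem_ctSet_of_ctP hL hb.2

end BondK

end Summit.CriticalPhenomena.PercolationContinuityZ3.Theorems.Pcint
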